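import Literature.MathematicalPhysics.QuantumFieldTheory.Balaban1983to89.B12Form543
import Literature.MathematicalPhysics.QuantumFieldTheory.Balaban1983to89.B12Marginal444

/-!
# Bałaban CMP 109 (1987) §4 pp. 290–292 ↔ §5 p. 297: the moment identities (4.43), (4.45) WRITTEN FOR THE VACUUM
POLARIZATION TENSOR Π (sums over y extended to the whole lattice), and blocks 2–3 of the table (4.34) for Π —
«The corresponding terms from (4.34) are equal to (4.42), (4.44) also» — derived in the kernel from the printed
symmetries (5.6), (5.7), (5.9)₁ and the decay (5.10)

CITATION HEADER (lean-in-tree rule 2026-08-18).  Source: T. Bałaban, *Renormalization group approach to lattice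
gauge field theories. I. Generation of effective actions in a small field approximation and a coupling constant
renormalization in four dimensions*, Commun. Math. Phys. **109**, 249–301 (1987), doi:10.1007/bf01215223
[Balaban1987RG1] (held: `paper:balaban1987-cmp109-rg-i-small-field`; journal page = PDF page + 248).  The displays
and sentences quoted below were READ AS IMAGES on the 300-dpi renders of p. 290 [PDF 42], p. 291 [43] and p. 292 [44]
(`HOME/b2b-balaban-ref1/pages/1987-cmp109-rg-I-small-field/…-p042-x2.png`, `…-p043-x2.png`, `…-p044-x2.png`,
HOME = the audit cell folder `run/shared/lean/pub/pub-balaban/`) and agree with the audited lineage transcript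
`HOME/b2b-balaban-b03/B12s-transcript.md` (§4 pp. 281–292, §5 pp. 292–298).  Audit cell `pub-balaban`, unit
`b2b-balaban-b03-g9` (B12 §§2–5 lineage), node B12-MOMENTS-443-PI.  Imports only the lineage's own modules
`…Balaban1983to89.B12Form543` (hence `…B12Transverse536`, `…B12Rep537`, the periodic Gleason toolkit
`…GawedzkiKupiainen1985.PeriodicGleason`) and `…Balaban1983to89.B12Marginal444`; modifies nothing.
Value = kernel certificate joining two audited pieces of the SAME paper — the §5 output (second-order Taylor data of
Π, `B12Transverse536.taylorData3_of_symmetries`) is fed into the §4 bookkeeping (`B12Marginal444.dens444pt`,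
`moment443_contract4`, `cubic444`, `quartic444`) — so that the paper's sentence p. 292 about blocks 2 and 3 of (4.34)
for Π holds as a THEOREM from (5.6) + (5.7) + (5.9)₁ + (5.10), with β the second moment (5.42)/(1.22)
(`B12Beta.secondMoment`), whatever its value.  NOT summit progress; nothing is asserted about Bałaban's functions
`E^{(n)}`, the resummations (4.35)–(4.37) producing Π, the irrelevance of any dropped term, the operator `Δ_j` of
(1.66) [10], or the sign or size of β (cell GAPS G-B12s-*, the BETA table).

THE PRINTED TEXT (verbatim; Π, Δ_j, β_j(g_{j−1}) as printed; (4.34) itself is quoted in full in the header of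
`…B12Marginal444`).
* p. 290, after (4.35): «Next, we extend summations over y to the whole lattice Z⁴. The difference between the sum
  over supp ζ̃_□ and the sum over Z⁴ is a sum over a subset of (□̃³)ᶜ∩Z⁴. This gives again the exponentially small
  coefficients.»
* p. 291, (4.37) and the two sentences after it: «Thus, after all the changes and resummations, we obtain an
  expression which is equal to this in (4.34), with the function E^{(2)}_{μ,ν}(X, x, y) replaced by
  Π_{μ,ν}(x, y) = Σ_{X∈D⁰_j} E^{(2)}_{μ,ν}(X, x, y),  (4.37)  and the irrelevant terms resummed over X ∈ D_j,
  X ⊂ □̃². The function Π is called the vacuum polarization tensor. We will investigate it in the next section.»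
* p. 291, (4.43): «In the second term we have the expression
  β_j(g_{j−1}) Σ_y Δ_{j,μν}(x − y)(y_κ − x_κ)(y_λ − x_λ) = −β_j(g_{j−1}) (∂²/∂p′_κ∂p′_λ Δ_{j,μν})(0)
  = β_j(g_{j−1}) (δ_{μκ}δ_{νλ} + δ_{μλ}δ_{νκ} − 2δ_{μν}δ_{κλ}).  (4.43)
  Using this equality we represent the second term as» (4.44) [the density `…B12Marginal444.dens444pt`, quoted
  there].
* p. 292, (4.45) and the paragraph after it: «In the third term we have the expression
  β_j(g_{j−1}) Σ_y Δ_{k,μν}(x − y)(y_κ − x_κ) = β_j(g_{j−1}) ((1/i) ∂/∂p′_κ Δ_{j,μν})(0) = 0,  (4.45)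
  hence this term vanishes. Thus the only terms in the expansion of (4.38), which we do not control yet, more
  exactly for which the sum over j has not a uniform bound, are terms (4.42), (4.44). In the next section we will
  prove that the polarization tensor Π has a similar structure as the operator Δ_j, especially it has an expansion
  of the form (4.41), but with a coefficient. We define the β-function β_j(g_{j−1}) equal to this coefficient. The
  corresponding terms from (4.34) are equal to (4.42), (4.44) also, hence both groups of terms cancel, because
  (4.38) appears with the minus sign in the effective action (1.6).»  [typo, cosmetic: «Δ_{k,μν}» in (4.45) for
  Δ_{j,μν}.]
* p. 297, (5.42): «β = Σ_x Π_{μν}(x)x_μx_ν for μ ≠ ν» (quoted in full in `…B12Rep537`, `…B12Transverse536`).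

DICTIONARY (ours ↔ print).  `Pt d = Fin d → ℤ` is the unit lattice (the print's ξZ⁴ rescaled, d = 4 there, arbitrary
here); a kernel family `Pc μ ν : Pt d → ℂ` is `Π_{μν}(x − y)` as a function of the difference ((5.8) p. 293:
«Π_{μν}(x, y) = Π_{μν}(x − y)»), the real B12 kernel `P : B12Beta.Kernel d` is read in ℂ by `B12Form543.ofRealK`;
`M0x Pc x μ ν`, `M1x Pc x μ ν κ`, `M2x Pc x μ ν κ λ` are the zeroth / first / second moment kernels
`Σ_y Π_{μν}(x − y)`, `Σ_y Π_{μν}(x − y)(y_κ − x_κ)`, `Σ_y Π_{μν}(x − y)(y_κ − x_κ)(y_λ − x_λ)` of (4.34)₂,₃ / (4.43) /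
(4.45) with «summations over y» extended «to the whole lattice» (p. 290) — genuine lattice series `∑'`; `block2x`,
`block3x` are blocks 2 and 3 of (4.34) (the bodies of `…B12Marginal444.block2`, `block3`, coefficient for coefficient)
with the finite-range moment kernels `M2`, `M1` replaced by `M2x`, `M1x`, over complex `n × n` matrices
(`𝕜 = A = ℂ` in `…B12Marginal444`'s vocabulary: `ibr c X Y = c(XY − YX)` is the print's `i[X, Y]` with the scalar
`i` kept as a parameter `c`, `δB B : Fin d → Matrix n n ℂ` the fields at the point x, `C κ ν = (∂_κB_ν)(x)`);
`kdA` is Kronecker's δ; β = `B12Beta.secondMoment P μ₀ ν₀` (= (5.42) = (1.22), any `μ₀ ≠ ν₀`) read in ℂ.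

WHAT IS PROVED (every `theorem` kernel-checked; `d`, `n` arbitrary).
* §1 [folklore] the change of variables y = x − z: `M2x_eq_central` (`Σ_y Π(x − y)(y_κ − x_κ)(y_λ − x_λ)
  = Σ_z Π(z)z_κz_λ`), `M1x_eq_central` (`… = −Σ_z Π(z)z_κ`), `M0x_eq_central`; and, under an exponential bound
  (in particular under (5.10)), absolute convergence of the three series (`summable_M2x`, `summable_M1x`,
  `summable_M0x`) — the `∑'` are sums, not junk values.
* §2 the moment identities from second-order Taylor data `B12Rep537.TaylorData3 β μ ν Π_{μν}` («Π has a similar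
  structure as the operator Δ_j, especially it has an expansion of the form (4.41), but with a coefficient»):
  `moments443` — (4.43) FOR Π, letter for letter: `Σ_y Π_{μν}(x − y)(y_κ − x_κ)(y_λ − x_λ)
  = β(δ_{μκ}δ_{νλ} + δ_{μλ}δ_{νκ} − 2δ_{μν}δ_{κλ})`; `moments445` — (4.45) FOR Π: `Σ_y Π_{μν}(x − y)(y_κ − x_κ) = 0`;
  `moments0` — `Σ_y Π_{μν}(x − y) = 0` (no mass term).
* §3 «The corresponding terms from (4.34) are equal to (4.42), (4.44) also» for blocks 2 and 3:
  `block2x_of_taylorData3` — block 2 of (4.34) for Π = β × [the density (4.44), `dens444pt`, with the field strength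
  `(∂B)_{μν}` in the first bracket as in `…B12Marginal444` remark (M1)]; `block3x_of_taylorData3` — block 3 of (4.34)
  for Π = 0.  (Block 1 ↔ (4.42) is (5.43), certified in `…B12Form543.form543_of_symmetries`.)
* §4 FROM THE PRINTED SYMMETRIES ALONE: for a real kernel family with the decay (5.10) of every component, the
  permutation covariance (5.6)/(5.12) (`B12Beta.PermCovariant`), the reflection covariance (5.7)/(5.13)
  (`B12Transverse536.ReflCovariant`) and the first Ward identity (5.9)/(5.15) (`B12Transverse536.WardFirst`):
  `moments443_of_symmetries`, `moments445_of_symmetries`, `moments0_of_symmetries`, `block2x_of_symmetries`,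
  `block3x_of_symmetries`, with β = `B12Beta.secondMoment P μ₀ ν₀` for any fixed `μ₀ ≠ ν₀` — via
  `B12Transverse536.taylorData3_of_symmetries`.
NOT PROVED HERE / NOT CLAIMED: (4.35)–(4.37) (the changes and resummations producing Π from the `E^{(2)}(X)`, and
the exponential smallness of every difference, incl. the extension of Σ_y to the whole lattice); (4.38)–(4.41) and
(4.43)/(4.45) for Bałaban's Δ_j (by reference to (1.66), (1.29)–(1.37) of [10]); that Π SATISFIES (5.6), (5.7),
(5.9), (5.10) (the paper derives them from (5.1)–(5.4), (4.15) and Proposition 3 — hypotheses here, as in the whole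
lineage); the irrelevance of any term; the sign or size of β.
-/

namespace Literature.MathematicalPhysics.QuantumFieldTheory.Balaban1983to89.B12Moments443

noncomputable section

open Literature.MathematicalPhysics.QuantumFieldTheory.GawedzkiKupiainen1985.PeriodicGleason
open Literature.MathematicalPhysics.QuantumFieldTheory.Balaban1983to89.B12Rep537
open Literature.MathematicalPhysics.QuantumFieldTheory.Balaban1983to89.B12Transverse536
open Literature.MathematicalPhysics.QuantumFieldTheory.Balaban1983to89.B12Form543
open Literature.MathematicalPhysics.QuantumFieldTheory.Balaban1983to89.B12Marginal444

variable {d : ℕ}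

/-! ## §1 The moment kernels of (4.34)₂,₃ / (4.43) / (4.45) with «summations over y» over the whole lattice -/

/-- `Σ_y Π_{μν}(x − y)` (y over the whole lattice). [cite: Balaban1987RG1, (4.34) p.289; p.290] -/
def M0x (Pc : Fin d → Fin d → Pt d → ℂ) (x : Pt d) (μ ν : Fin d) : ℂ := ∑' y : Pt d, Pc μ ν (x - y)

/-- `Σ_y Π_{μν}(x − y)(y_κ − x_κ)` — the first-moment kernel of (4.34)₃ / (4.45), y over the whole lattice.
[cite: Balaban1987RG1, (4.45) p.292; (4.34) p.289; p.290] -/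
def M1x (Pc : Fin d → Fin d → Pt d → ℂ) (x : Pt d) (μ ν κ : Fin d) : ℂ :=
  ∑' y : Pt d, Pc μ ν (x - y) * ((y κ - x κ : ℤ) : ℂ)

/-- `Σ_y Π_{μν}(x − y)(y_κ − x_κ)(y_λ − x_λ)` — the second-moment kernel of (4.34)₂ / (4.43), y over the whole
lattice. [cite: Balaban1987RG1, (4.43) p.291; (4.34) p.289; p.290] -/
def M2x (Pc : Fin d → Fin d → Pt d → ℂ) (x : Pt d) (μ ν κ l : Fin d) : ℂ :=
  ∑' y : Pt d, Pc μ ν (x - y) * (((y κ - x κ : ℤ) : ℂ) * ((y l - x l : ℤ) : ℂ))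

/-- Change of variables `y = x − z`: `Σ_y Π(x − y)(y_κ − x_κ)(y_λ − x_λ) = Σ_z Π(z)z_κz_λ` (the two signs cancel).
[folklore] -/
theorem M2x_eq_central (Pc : Fin d → Fin d → Pt d → ℂ) (x : Pt d) (μ ν κ l : Fin d) :
    M2x Pc x μ ν κ l = ∑' z : Pt d, Pc μ ν z * (((z κ : ℤ) : ℂ) * ((z l : ℤ) : ℂ)) := by
  refine ((Equiv.subLeft x).tsum_eq fun y : Pt d =>
    Pc μ ν (x - y) * (((y κ - x κ : ℤ) : ℂ) * ((y l - x l : ℤ) : ℂ))).symm.trans ?_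
  exact tsum_congr fun z => by
    simp only [Equiv.subLeft_apply, sub_sub_cancel, Pi.sub_apply, Int.cast_sub]; ring

/-- Change of variables `y = x − z`: `Σ_y Π(x − y)(y_κ − x_κ) = −Σ_z Π(z)z_κ`. [folklore] -/
theorem M1x_eq_central (Pc : Fin d → Fin d → Pt d → ℂ) (x : Pt d) (μ ν κ : Fin d) :
    M1x Pc x μ ν κ = -∑' z : Pt d, Pc μ ν z * ((z κ : ℤ) : ℂ) := by
  rw [← tsum_neg]
  refine ((Equiv.subLeft x).tsum_eq fun y : Pt d => Pc μ ν (x - y) * ((y κ - x κ : ℤ) : ℂ)).symm.trans ?_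
  exact tsum_congr fun z => by
    simp only [Equiv.subLeft_apply, sub_sub_cancel, Pi.sub_apply, Int.cast_sub]; ring

/-- Change of variables `y = x − z`: `Σ_y Π(x − y) = Σ_z Π(z)`. [folklore] -/
theorem M0x_eq_central (Pc : Fin d → Fin d → Pt d → ℂ) (x : Pt d) (μ ν : Fin d) :
    M0x Pc x μ ν = ∑' z : Pt d, Pc μ ν z := by
  refine ((Equiv.subLeft x).tsum_eq fun y : Pt d => Pc μ ν (x - y)).symm.trans ?_
  exact tsum_congr fun z => by simp only [Equiv.subLeft_apply, sub_sub_cancel]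

/-- Under an exponential bound (e.g. (5.10)) the series `Σ_y Π(x − y)(y_κ − x_κ)(y_λ − x_λ)` converges absolutely.
[folklore] -/
theorem summable_M2x {Pk : Pt d → ℂ} {a M : ℝ} (ha : 0 < a) (hP : ExpBound a M Pk) (x : Pt d) (κ l : Fin d) :
    Summable fun y : Pt d => Pk (x - y) * (((y κ - x κ : ℤ) : ℂ) * ((y l - x l : ℤ) : ℂ)) := by
  have hs : Summable fun z : Pt d => Pk z * (((z κ : ℤ) : ℂ) * ((z l : ℤ) : ℂ)) := by
    have h := hP.summable_mul ha (norm_monom_le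
      (fun j : Fin d => (if j = κ then 1 else 0) + (if j = l then 1 else 0))
      (le_deg (fun j : Fin d => (if j = κ then 1 else 0) + (if j = l then 1 else 0))))
    simp_rw [monom_pair] at h
    exact h
  have e : (fun y : Pt d => Pk (x - y) * (((y κ - x κ : ℤ) : ℂ) * ((y l - x l : ℤ) : ℂ)))
      = (fun z : Pt d => Pk z * (((z κ : ℤ) : ℂ) * ((z l : ℤ) : ℂ))) ∘ (Equiv.subLeft x) := by
    funext y
    simp only [Function.comp_apply, Equiv.subLeft_apply, Pi.sub_apply, Int.cast_sub]; ring
  rw [e]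
  exact (Equiv.subLeft x).summable_iff.mpr hs

/-- Under an exponential bound the series `Σ_y Π(x − y)(y_κ − x_κ)` converges absolutely. [folklore] -/
theorem summable_M1x {Pk : Pt d → ℂ} {a M : ℝ} (ha : 0 < a) (hP : ExpBound a M Pk) (x : Pt d) (κ : Fin d) :
    Summable fun y : Pt d => Pk (x - y) * ((y κ - x κ : ℤ) : ℂ) := by
  have hs : Summable fun z : Pt d => Pk z * ((z κ : ℤ) : ℂ) := by
    have h := hP.summable_mul ha (norm_monom_le (ind κ) (fun j => le_deg _ j))
    simp_rw [monom_ind] at h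
    exact h
  have e : (fun y : Pt d => Pk (x - y) * ((y κ - x κ : ℤ) : ℂ))
      = (fun z : Pt d => -(Pk z * ((z κ : ℤ) : ℂ))) ∘ (Equiv.subLeft x) := by
    funext y
    simp only [Function.comp_apply, Equiv.subLeft_apply, Pi.sub_apply, Int.cast_sub]; ring
  rw [e]
  exact (Equiv.subLeft x).summable_iff.mpr hs.neg

/-- Under an exponential bound the series `Σ_y Π(x − y)` converges absolutely. [folklore] -/
theorem summable_M0x {Pk : Pt d → ℂ} {a M : ℝ} (ha : 0 < a) (hP : ExpBound a M Pk) (x : Pt d) :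
    Summable fun y : Pt d => Pk (x - y) := by
  have e : (fun y : Pt d => Pk (x - y)) = Pk ∘ (Equiv.subLeft x) := by
    funext y; simp only [Function.comp_apply, Equiv.subLeft_apply]
  rw [e]
  exact (Equiv.subLeft x).summable_iff.mpr (hP.summable ha)

/-! ## §2 (4.43), (4.45) for a kernel with the second-order Taylor data of `βQ_{μν}` («an expansion of the form
(4.41), but with a coefficient») -/

/-- `deg e_κ = 1`. [folklore] -/
theorem deg_ind (κ : Fin d) : deg (ind κ) = 1 := by
  simp only [deg, ind, Finset.sum_ite_eq', Finset.mem_univ, if_true]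

/-- Taylor data ⇒ zeroth moment `Σ_x Π(x) = 0`. [cite: Balaban1987RG1, (5.16) p.293 / (5.36) p.297] -/
theorem tsum_eq_zero_of_taylorData3 {Pk : Pt d → ℂ} {β : ℂ} {μ ν : Fin d} (hT : TaylorData3 β μ ν Pk) :
    ∑' x, Pk x = 0 := by
  have h0 : deg (fun _ : Fin d => (0 : ℕ)) = 0 := by simp [deg]
  have h := hT (fun _ => 0) (by rw [h0]; norm_num)
  simp_rw [monom_of_deg_eq_zero h0, mul_one] at h
  rw [h, tsum_wilsonQ, mul_zero]

/-- Taylor data ⇒ first moments `Σ_x Π(x)x_κ = 0`. [cite: Balaban1987RG1, (5.16) p.293 / (5.36) p.297] -/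
theorem tsum_mul_coord_eq_zero_of_taylorData3 {Pk : Pt d → ℂ} {β : ℂ} {μ ν : Fin d}
    (hT : TaylorData3 β μ ν Pk) (κ : Fin d) : ∑' x : Pt d, Pk x * ((x κ : ℤ) : ℂ) = 0 := by
  have h := hT (ind κ) (by rw [deg_ind]; norm_num)
  simp_rw [monom_ind] at h
  rw [h, tsum_wilsonQ_mul_coord, mul_zero]

/-- Taylor data ⇒ second moments `Σ_x Π(x)x_κx_λ = β(−2δ_{μν}δ_{λκ} + δ_{κμ}δ_{λν} + δ_{κν}δ_{λμ})` (the table of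
`Q_{μν}`, `B12Rep537.tsum_wilsonQ_mul_coord2`). [cite: Balaban1987RG1, (5.16) p.293 / (5.36)–(5.37) p.297] -/
theorem tsum_mul_coord2_of_taylorData3 {Pk : Pt d → ℂ} {β : ℂ} {μ ν : Fin d} (hT : TaylorData3 β μ ν Pk)
    (κ l : Fin d) : ∑' x : Pt d, Pk x * (((x κ : ℤ) : ℂ) * ((x l : ℤ) : ℂ)) =
      β * (-(2 * kron μ ν * kron l κ) + kron κ μ * kron l ν + kron κ ν * kron l μ) := by
  have hdeg : deg (fun j : Fin d => (if j = κ then 1 else 0) + (if j = l then 1 else 0)) < 3 := by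
    simp only [deg, Finset.sum_add_distrib, Finset.sum_ite_eq', Finset.mem_univ, if_true]
    norm_num
  have h := hT _ hdeg
  simp_rw [monom_pair] at h
  rw [h, tsum_wilsonQ_mul_coord2]

/-- The two Kronecker deltas of the lineage agree (`B12Rep537.kron` = `B12Marginal444.kdA` at `A = ℂ`). [folklore] -/
theorem kron_eq_kdA (i j : Fin d) : kron i j = kdA (A := ℂ) i j := rfl

/-- **(4.43) written for Π** (second-order Taylor data of `βQ_{μν}` for every component ⇒):
`Σ_y Π_{μν}(x − y)(y_κ − x_κ)(y_λ − x_λ) = β(δ_{μκ}δ_{νλ} + δ_{μλ}δ_{νκ} − 2δ_{μν}δ_{κλ})` for every x.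
[cite: Balaban1987RG1, (4.43) p.291; p.292; (5.36)–(5.37) p.297] -/
theorem moments443 {Pc : Fin d → Fin d → Pt d → ℂ} {β : ℂ} (hT : ∀ μ ν, TaylorData3 β μ ν (Pc μ ν))
    (x : Pt d) (μ ν κ l : Fin d) :
    M2x Pc x μ ν κ l = β * (kdA μ κ * kdA ν l + kdA μ l * kdA ν κ - 2 * kdA μ ν * kdA κ l) := by
  rw [M2x_eq_central, tsum_mul_coord2_of_taylorData3 (hT μ ν),
    kron_comm l κ, kron_comm κ μ, kron_comm l ν, kron_comm κ ν, kron_comm l μ]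
  simp only [kron_eq_kdA]
  ring

/-- **(4.45) written for Π**: `Σ_y Π_{μν}(x − y)(y_κ − x_κ) = 0` for every x («hence this term vanishes»).
[cite: Balaban1987RG1, (4.45) p.292; (5.36)–(5.37) p.297] -/
theorem moments445 {Pc : Fin d → Fin d → Pt d → ℂ} {β : ℂ} (hT : ∀ μ ν, TaylorData3 β μ ν (Pc μ ν))
    (x : Pt d) (μ ν κ : Fin d) : M1x Pc x μ ν κ = 0 := by
  rw [M1x_eq_central, tsum_mul_coord_eq_zero_of_taylorData3 (hT μ ν), neg_zero]

/-- The zeroth moments vanish too: `Σ_y Π_{μν}(x − y) = 0` (no mass counterterm; `Q̃_{μν}(0) = 0`).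
[cite: Balaban1987RG1, (5.16) p.293 / (5.36)–(5.37) p.297] -/
theorem moments0 {Pc : Fin d → Fin d → Pt d → ℂ} {β : ℂ} (hT : ∀ μ ν, TaylorData3 β μ ν (Pc μ ν))
    (x : Pt d) (μ ν : Fin d) : M0x Pc x μ ν = 0 := by
  rw [M0x_eq_central, tsum_eq_zero_of_taylorData3 (hT μ ν)]

/-! ## §3 Blocks 2 and 3 of (4.34) for Π: «The corresponding terms from (4.34) are equal to (4.42), (4.44) also» -/

section Blocks

variable {n : Type*} [Fintype n]

/-- **Block 2 of (4.34) with `E^{(2)}_{μ,ν}(X, x, y)` replaced by `Π_{μν}(x − y)`** ((4.37)), y over the whole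
lattice: `Σ_{μ,ν,κ,λ} (Σ_y Π_{μν}(x − y)(y_κ − x_κ)(y_λ − x_λ)) {tr δB_μ i[B_κ, ∂_λB_ν]
+ ⅓ tr δB_μ i[B_κ, i[B_λ, B_ν]]}` — the body of `…B12Marginal444.block2` with `M2` ↦ `M2x`.
[cite: Balaban1987RG1, (4.34) p.289; (4.37) p.291] -/
def block2x (Pc : Fin d → Fin d → Pt d → ℂ) (x : Pt d) (c : ℂ) (δB B : Fin d → Matrix n n ℂ)
    (C : Fin d → Fin d → Matrix n n ℂ) : ℂ :=
  ∑ μ, ∑ ν, ∑ κ, ∑ l, M2x Pc x μ ν κ l *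
    ((δB μ * ibr c (B κ) (C l ν)).trace + (3 : ℂ)⁻¹ • (δB μ * ibr c (B κ) (ibr c (B l) (B ν))).trace)

/-- **Block 3 of (4.34) with `E^{(2)}_{μ,ν}(X, x, y)` replaced by `Π_{μν}(x − y)`**, y over the whole lattice:
`Σ_{μ,ν,κ} (Σ_y Π_{μν}(x − y)(y_κ − x_κ)) {½ tr δB_μ i[B_κ, B_ν] − ½ tr δB_μ i[∂_κB_ν, B_ν] − ½ tr δB_μ i[B_μ, ∂_κB_ν]
− (1/3!) tr δB_μ i[i[B_κ, B_ν], B_ν] − ¼ tr δB_μ i[B_μ, i[B_κ, B_ν]]}` — the body of `…B12Marginal444.block3` with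
`M1` ↦ `M1x`. [cite: Balaban1987RG1, (4.34) pp.289–290; (4.37) p.291] -/
def block3x (Pc : Fin d → Fin d → Pt d → ℂ) (x : Pt d) (c : ℂ) (δB B : Fin d → Matrix n n ℂ)
    (C : Fin d → Fin d → Matrix n n ℂ) : ℂ :=
  ∑ μ, ∑ ν, ∑ κ, M1x Pc x μ ν κ *
    ((2 : ℂ)⁻¹ • (δB μ * ibr c (B κ) (B ν)).trace
      - (2 : ℂ)⁻¹ • (δB μ * ibr c (C κ ν) (B ν)).trace
      - (2 : ℂ)⁻¹ • (δB μ * ibr c (B μ) (C κ ν)).trace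
      - ((Nat.factorial 3 : ℕ) : ℂ)⁻¹ • (δB μ * ibr c (ibr c (B κ) (B ν)) (B ν)).trace
      - (4 : ℂ)⁻¹ • (δB μ * ibr c (B μ) (ibr c (B κ) (B ν))).trace)

/-- **Block 2 of (4.34) for Π equals β × the density (4.44)** (`…B12Marginal444.dens444pt`: `Σ_{μ,ν} tr δB_μ
{i[B_ν, (∂B)_{μν}] + i[B_μ, ∂_νB_ν] + i[∂_νB_μ, B_ν] + i[B_ν, i[B_μ, B_ν]]}`, field strength in the first bracket,
remark (M1) there), for every kernel family whose components have the second-order Taylor data of `βQ_{μν}` — «The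
corresponding terms from (4.34) are equal to (4.42), (4.44) also», block 2.
[cite: Balaban1987RG1, (4.43)–(4.44) p.291; p.292] -/
theorem block2x_of_taylorData3 {Pc : Fin d → Fin d → Pt d → ℂ} {β : ℂ}
    (hT : ∀ μ ν, TaylorData3 β μ ν (Pc μ ν)) (x : Pt d) (c : ℂ) (δB B : Fin d → Matrix n n ℂ)
    (C : Fin d → Fin d → Matrix n n ℂ) :
    block2x Pc x c δB B C = β * dens444pt c δB B C := by
  unfold block2x dens444pt
  simp_rw [moments443 hT]
  have h := moment443_contract4 β (fun μ ν κ l =>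
    (δB μ * ibr c (B κ) (C l ν)).trace + (3 : ℂ)⁻¹ • (δB μ * ibr c (B κ) (ibr c (B l) (B ν))).trace)
  beta_reduce at h
  rw [h]
  congr 1
  refine Finset.sum_congr rfl fun μ _ => Finset.sum_congr rfl fun ν _ => ?_
  have hc := congrArg (fun X : Matrix n n ℂ => (δB μ * X).trace) (cubic444 c B C μ ν)
  have hq := congrArg (fun X : Matrix n n ℂ => (δB μ * X).trace) (quartic444 c B μ ν)
  simp only [Matrix.mul_add, Matrix.mul_sub, Matrix.mul_smul, Matrix.trace_add, Matrix.trace_sub,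
    Matrix.trace_smul, smul_eq_mul] at hc hq ⊢
  linear_combination hc + hq

/-- **Block 3 of (4.34) for Π vanishes** ((4.45) for Π: «hence this term vanishes»), for every kernel family whose
components have the second-order Taylor data of `βQ_{μν}`. [cite: Balaban1987RG1, (4.45) p.292] -/
theorem block3x_of_taylorData3 {Pc : Fin d → Fin d → Pt d → ℂ} {β : ℂ}
    (hT : ∀ μ ν, TaylorData3 β μ ν (Pc μ ν)) (x : Pt d) (c : ℂ) (δB B : Fin d → Matrix n n ℂ)
    (C : Fin d → Fin d → Matrix n n ℂ) :
    block3x Pc x c δB B C = 0 := by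
  unfold block3x
  simp [moments445 hT]

end Blocks

/-! ## §4 For the vacuum polarization tensor, from (5.6) + (5.7) + (5.9)₁ + (5.10): β = (5.42) = (1.22) -/

section Symmetries

variable {P : B12Beta.Kernel d} {C₁ δ₁ : ℝ} {μ₀ ν₀ : Fin d}

/-- **(4.43) FOR Π from the printed symmetries**: decay (5.10) of every component, permutation covariance (5.6),
reflection covariance (5.7), first Ward identity (5.9)₁ ⇒ for every x, μ, ν, κ, λ:
`Σ_y Π_{μν}(x − y)(y_κ − x_κ)(y_λ − x_λ) = β(δ_{μκ}δ_{νλ} + δ_{μλ}δ_{νκ} − 2δ_{μν}δ_{κλ})`,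
`β = Σ_x Π_{μ₀ν₀}(x)x_{μ₀}x_{ν₀}` (any `μ₀ ≠ ν₀`).
[cite: Balaban1987RG1, (4.43) p.291; p.292; (5.36)–(5.37), (5.42) p.297] -/
theorem moments443_of_symmetries (hδ : 0 < δ₁) (h510 : ∀ μ ν, B12Sec2to5.Decay510 (P μ ν) C₁ δ₁)
    (hperm : B12Beta.PermCovariant P) (hrefl : ReflCovariant P) (hward : WardFirst P) (h0 : μ₀ ≠ ν₀)
    (x : Pt d) (μ ν κ l : Fin d) :
    M2x (ofRealK P) x μ ν κ l = ((B12Beta.secondMoment P μ₀ ν₀ : ℝ) : ℂ) *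
      (kdA μ κ * kdA ν l + kdA μ l * kdA ν κ - 2 * kdA μ ν * kdA κ l) :=
  moments443 (Pc := ofRealK P) (fun μ ν => taylorData3_of_symmetries hδ h510 hperm hrefl hward h0 μ ν) x μ ν κ l

/-- **(4.45) FOR Π from the printed symmetries**: `Σ_y Π_{μν}(x − y)(y_κ − x_κ) = 0`.
[cite: Balaban1987RG1, (4.45) p.292; (5.36)–(5.37) p.297] -/
theorem moments445_of_symmetries (hδ : 0 < δ₁) (h510 : ∀ μ ν, B12Sec2to5.Decay510 (P μ ν) C₁ δ₁)
    (hperm : B12Beta.PermCovariant P) (hrefl : ReflCovariant P) (hward : WardFirst P) (h0 : μ₀ ≠ ν₀)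
    (x : Pt d) (μ ν κ : Fin d) : M1x (ofRealK P) x μ ν κ = 0 :=
  moments445 (Pc := ofRealK P) (fun μ ν => taylorData3_of_symmetries hδ h510 hperm hrefl hward h0 μ ν) x μ ν κ

/-- The zeroth moments of Π vanish, from the printed symmetries: `Σ_y Π_{μν}(x − y) = 0`.
[cite: Balaban1987RG1, (5.16) p.293 / (5.36)–(5.37) p.297] -/
theorem moments0_of_symmetries (hδ : 0 < δ₁) (h510 : ∀ μ ν, B12Sec2to5.Decay510 (P μ ν) C₁ δ₁)
    (hperm : B12Beta.PermCovariant P) (hrefl : ReflCovariant P) (hward : WardFirst P) (h0 : μ₀ ≠ ν₀)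
    (x : Pt d) (μ ν : Fin d) : M0x (ofRealK P) x μ ν = 0 :=
  moments0 (Pc := ofRealK P) (fun μ ν => taylorData3_of_symmetries hδ h510 hperm hrefl hward h0 μ ν) x μ ν

/-- Under (5.10) the three moment series of Π converge absolutely (the identities above are equalities of sums).
[cite: Balaban1987RG1, (5.10) p.293] -/
theorem summable_moments_of_decay510 (hδ : 0 < δ₁) (h510 : ∀ μ ν, B12Sec2to5.Decay510 (P μ ν) C₁ δ₁)
    (x : Pt d) (μ ν κ l : Fin d) :
    Summable (fun y : Pt d => ofRealK P μ ν (x - y) * (((y κ - x κ : ℤ) : ℂ) * ((y l - x l : ℤ) : ℂ))) ∧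
      Summable (fun y : Pt d => ofRealK P μ ν (x - y) * ((y κ - x κ : ℤ) : ℂ)) ∧
        Summable (fun y : Pt d => ofRealK P μ ν (x - y)) :=
  ⟨summable_M2x hδ (expBound_of_decay510 (h510 μ ν)) x κ l,
    summable_M1x hδ (expBound_of_decay510 (h510 μ ν)) x κ,
    summable_M0x hδ (expBound_of_decay510 (h510 μ ν)) x⟩

variable {n : Type*} [Fintype n]

/-- **«The corresponding terms from (4.34) are equal to (4.42), (4.44) also» — block 2, FOR Π, from the printed
symmetries**: block 2 of (4.34) with `E^{(2)}` replaced by Π (y over the whole lattice) equals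
`β × Σ_{μ,ν} tr δB_μ{i[B_ν, (∂B)_{μν}] + i[B_μ, ∂_νB_ν] + i[∂_νB_μ, B_ν] + i[B_ν, i[B_μ, B_ν]]}` at the point x, with
β = `B12Beta.secondMoment P μ₀ ν₀` = (5.42) = (1.22).
[cite: Balaban1987RG1, p.292; (4.43)–(4.44) p.291; (5.42) p.297] -/
theorem block2x_of_symmetries (hδ : 0 < δ₁) (h510 : ∀ μ ν, B12Sec2to5.Decay510 (P μ ν) C₁ δ₁)
    (hperm : B12Beta.PermCovariant P) (hrefl : ReflCovariant P) (hward : WardFirst P) (h0 : μ₀ ≠ ν₀)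
    (x : Pt d) (c : ℂ) (δB B : Fin d → Matrix n n ℂ) (C : Fin d → Fin d → Matrix n n ℂ) :
    block2x (ofRealK P) x c δB B C = ((B12Beta.secondMoment P μ₀ ν₀ : ℝ) : ℂ) * dens444pt c δB B C :=
  block2x_of_taylorData3 (Pc := ofRealK P)
    (fun μ ν => taylorData3_of_symmetries hδ h510 hperm hrefl hward h0 μ ν) x c δB B C

/-- **«… hence this term vanishes» — block 3, FOR Π, from the printed symmetries**: block 3 of (4.34) with `E^{(2)}`
replaced by Π (y over the whole lattice) is zero. [cite: Balaban1987RG1, (4.45) p.292] -/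
theorem block3x_of_symmetries (hδ : 0 < δ₁) (h510 : ∀ μ ν, B12Sec2to5.Decay510 (P μ ν) C₁ δ₁)
    (hperm : B12Beta.PermCovariant P) (hrefl : ReflCovariant P) (hward : WardFirst P) (h0 : μ₀ ≠ ν₀)
    (x : Pt d) (c : ℂ) (δB B : Fin d → Matrix n n ℂ) (C : Fin d → Fin d → Matrix n n ℂ) :
    block3x (ofRealK P) x c δB B C = 0 :=
  block3x_of_taylorData3 (Pc := ofRealK P)
    (fun μ ν => taylorData3_of_symmetries hδ h510 hperm hrefl hward h0 μ ν) x c δB B C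

end Symmetries

end

end Literature.MathematicalPhysics.QuantumFieldTheory.Balaban1983to89.B12Moments443
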